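import Literature.MathematicalPhysics.QuantumLattice.FermionQuasiFree
import Literature.MathematicalPhysics.QuantumLattice.FreeFermionSpinTwistedTraceFormula
import Literature.MathematicalPhysics.QuantumLattice.HubbardLiebConfig
import HarnessLib

/-!
# Free-gas (`U = 0`) current clustering for TcThermcert1's Hypothesis C — part 2: the canonical pull-through expansion

Helper file for route `TcThermcert1` (crux K1′ `ThermalStiffnessCeilingU8b8_le_7o44`, item `stmt-Ventures-24560`; line
`Cruxes/ThermalStiffnessCeilingU8b8_le_7o44/Lines/gauge_qbp_far_seam.lean` v1.4, Hypothesis C = `CurrentClustering U n β ξ`).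

For a quadratic Hamiltonian `dΓ(h)` on the fermionic Fock space over the orbitals `Orb Λ = Λ × {↑,↓}` whose one-body Gibbs factor
`E = e^{-βh}` is spin-block-diagonal, and ANY family of matrices `P_m` intertwined by the spin-`σ` annihilators
(`P_m c_{xσ} = c_{xσ} P_{m+1}`, `c_{xσ} P_0 = 0` — the sector projections `P_{(m, b)}` resp. `P_{(a, m)}` are the intended instance),
write `T_m(O) = tr(P_m e^{-β dΓ(h)} O)`. Gaudin's pull-through `c_q e^{-βdΓ(h)} = Σ_k E_{qk} e^{-βdΓ(h)} c_k` (tree: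
`annihilation_mul_gibbsWeight_dGamma`), cyclicity of the trace and the CAR give the ONE-STEP identity (§1)

  `T_{m+1}(A c†_p c_{xσ}) = Σ_y E_{xσ,yσ} ( [yσ = p] T_m(A) + T_m([c_{yσ}, A] c†_p) − T_m(A c†_p c_{yσ}) )`,

valid for EVERY operator `A`, and by induction the exact, finite **canonical pull-through expansion** (§2)

  `T_m(A c†_p c_{xσ}) = Σ_{j<m} (−1)^j Σ_y (E^{j+1})_{xσ,yσ} ( [yσ = p] T_{m−j−1}(A) + T_{m−j−1}([c_{yσ}, A] c†_p) )`

(the canonical, fixed-particle-number replacement of the resummed quasi-free formula `⟨A c†_p c_q⟩ = ⟨A⟩ G_{qp} + Σ_y G_{qy} ⟨[c_y,A]c†_p⟩`;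
for `A = 1` it is the classical alternating formula for the canonical one-body density matrix of the ideal Fermi gas). §3: for the bond
CURRENT `j = −i c†_a c_b + i c†_b c_a` the `A`-terms cancel when `E^{j+1}` is symmetric, leaving only commutator terms — the algebraic
reason why the free canonical state clusters against the current with no Lebowitz–Percus plateau.

HONEST FRAMING: finite-dimensional algebra (folklore: Gaudin 1960; the canonical recursion of Borrmann–Franke type); nothing here touches
`U = 8`, the bet C8 or `T_c`; superconductivity in the Hubbard model is NOT proved (or disproved) by any of this.
-/

noncomputable section

namespace Summit.Ventures.CertifiedManyBodySolver.Theorems.TcThermcert1.FreeGasCurrentClustering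

open NormedSpace Matrix Finset
open Literature.MathematicalPhysics.QuantumLattice
open scoped ComplexOrder

variable {Λ : Type*} [LinearOrder Λ] [Fintype Λ]

/-! ## §1 The one-step identity -/

/-- CAR rearrangement: `c_k A c†_p = [c_k, A] c†_p + [k = p] A − A c†_p c_k`. -/
theorem annihilation_mul_mul_creation_eq (A : Matrix (Finset (Orb Λ)) (Finset (Orb Λ)) ℂ) (k p : Orb Λ) :
    annihilation k * A * creation p =
      (annihilation k * A - A * annihilation k) * creation p + (if k = p then A else 0) - A * (creation p * annihilation k) := by
  have hCAR : annihilation k * creation p = (if k = p then (1 : Matrix (Finset (Orb Λ)) (Finset (Orb Λ)) ℂ) else 0) -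
      creation p * annihilation k :=
    eq_sub_of_add_eq (annihilation_mul_creation_add_creation_mul_annihilation_holds k p)
  have h1 : annihilation k * A * creation p =
      (annihilation k * A - A * annihilation k) * creation p + A * annihilation k * creation p := by
    rw [Matrix.sub_mul, sub_add_cancel]
  rw [h1, Matrix.mul_assoc A (annihilation k) (creation p), hCAR, Matrix.mul_sub, mul_ite, Matrix.mul_one, Matrix.mul_zero]
  abel

/-- **Base of the expansion**: `T_0(A c†_p c_{xσ}) = 0` when `c_{xσ} P_0 = 0`. -/
theorem trace_P_zero_mul_gibbsWeight_mul_eq_zero (β : ℝ) (H : Matrix (Finset (Orb Λ)) (Finset (Orb Λ)) ℂ)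
    (P₀ : Matrix (Finset (Orb Λ)) (Finset (Orb Λ)) ℂ) {q : Orb Λ} (hP0 : annihilation q * P₀ = 0)
    (A : Matrix (Finset (Orb Λ)) (Finset (Orb Λ)) ℂ) (p : Orb Λ) :
    (P₀ * gibbsWeight β H * (A * (creation p * annihilation q))).trace = 0 := by
  calc (P₀ * gibbsWeight β H * (A * (creation p * annihilation q))).trace
      = ((P₀ * (gibbsWeight β H * A * creation p)) * annihilation q).trace := by simp only [Matrix.mul_assoc]
    _ = (annihilation q * (P₀ * (gibbsWeight β H * A * creation p))).trace := Matrix.trace_mul_comm _ _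
    _ = ((annihilation q * P₀) * (gibbsWeight β H * A * creation p)).trace := by simp only [Matrix.mul_assoc]
    _ = 0 := by rw [hP0, Matrix.zero_mul, Matrix.trace_zero]

/-- **One-step pull-through identity** (any operator `A`): with `E = e^{−βh}` spin-block-diagonal and `P_m c_{xσ} = c_{xσ} P_{m+1}`,
`T_{m+1}(A c†_p c_{xσ}) = Σ_y E_{xσ,yσ} ( [yσ = p] T_m(A) + T_m([c_{yσ}, A] c†_p) − T_m(A c†_p c_{yσ}) )`, `T_m(O) = tr(P_m e^{−βdΓ(h)} O)`. -/
theorem trace_P_succ_mul_gibbsWeight_dGamma_mul (β : ℝ) (h : Matrix (Orb Λ) (Orb Λ) ℂ)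
    (hE : ∀ q k : Orb Λ, (ofLex q).2 ≠ (ofLex k).2 → (exp (-((β : ℂ) • h))) q k = 0) (σ : Fin 2)
    (P P' : Matrix (Finset (Orb Λ)) (Finset (Orb Λ)) ℂ) (x : Λ)
    (hPc : P * annihilation (orb x σ) = annihilation (orb x σ) * P')
    (A : Matrix (Finset (Orb Λ)) (Finset (Orb Λ)) ℂ) (p : Orb Λ) :
    (P' * gibbsWeight β (dGamma h) * (A * (creation p * annihilation (orb x σ)))).trace =
      ∑ y : Λ, (exp (-((β : ℂ) • h))) (orb x σ) (orb y σ) *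
        ((if orb y σ = p then (P * gibbsWeight β (dGamma h) * A).trace else 0) +
          (P * gibbsWeight β (dGamma h) * ((annihilation (orb y σ) * A - A * annihilation (orb y σ)) * creation p)).trace -
          (P * gibbsWeight β (dGamma h) * (A * (creation p * annihilation (orb y σ)))).trace) := by
  set W := gibbsWeight β (dGamma h) with hW
  -- cyclicity of the trace and the intertwining
  have h1 : (P' * W * (A * (creation p * annihilation (orb x σ)))).trace =
      (P * (annihilation (orb x σ) * W) * (A * creation p)).trace := by
    calc (P' * W * (A * (creation p * annihilation (orb x σ)))).trace
        = ((P' * (W * A * creation p)) * annihilation (orb x σ)).trace := by simp only [Matrix.mul_assoc]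
      _ = (annihilation (orb x σ) * (P' * (W * A * creation p))).trace := Matrix.trace_mul_comm _ _
      _ = ((annihilation (orb x σ) * P') * (W * A * creation p)).trace := by simp only [Matrix.mul_assoc]
      _ = ((P * annihilation (orb x σ)) * (W * A * creation p)).trace := by rw [hPc]
      _ = (P * (annihilation (orb x σ) * W) * (A * creation p)).trace := by simp only [Matrix.mul_assoc]
  -- the pull-through formula
  have h2 : (P * (annihilation (orb x σ) * W) * (A * creation p)).trace =
      ∑ k : Orb Λ, (exp (-((β : ℂ) • h))) (orb x σ) k * (P * W * (annihilation k * A * creation p)).trace := by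
    rw [hW, annihilation_mul_gibbsWeight_dGamma, ← hW, Finset.mul_sum, Finset.sum_mul, Matrix.trace_sum]
    refine Finset.sum_congr rfl fun k _ => ?_
    simp only [Matrix.mul_smul, Matrix.smul_mul, Matrix.trace_smul, smul_eq_mul, Matrix.mul_assoc]
  -- only the orbitals of spin `σ` contribute
  have h3 : ∑ k : Orb Λ, (exp (-((β : ℂ) • h))) (orb x σ) k * (P * W * (annihilation k * A * creation p)).trace =
      ∑ y : Λ, (exp (-((β : ℂ) • h))) (orb x σ) (orb y σ) * (P * W * (annihilation (orb y σ) * A * creation p)).trace := by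
    rw [sum_orb_eq_sum_sum]
    refine Finset.sum_congr rfl fun y _ => ?_
    rw [Finset.sum_eq_single σ]
    · intro τ _ hτ
      exact mul_eq_zero_of_left (hE (orb x σ) (orb y τ) (Ne.symm hτ)) _
    · intro hσ; exact absurd (Finset.mem_univ σ) hσ
  rw [h1, h2, h3]
  refine Finset.sum_congr rfl fun y _ => ?_
  rw [annihilation_mul_mul_creation_eq A (orb y σ) p, Matrix.mul_sub, Matrix.mul_add, Matrix.trace_sub, Matrix.trace_add,
    mul_ite, Matrix.mul_zero, apply_ite Matrix.trace, Matrix.trace_zero]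
  ring

/-! ## §2 The expansion -/

/-- Resummation step of the induction: with `w n z` arbitrary and `E` spin-block-diagonal,
`Σ_z E_{xz} w m z − Σ_y E_{xy} [Σ_{j<m} (−1)^j Σ_z (E^{j+1})_{yz} w (m−(j+1)) z] = Σ_{j<m+1} (−1)^j Σ_z (E^{j+1})_{xz} w (m+1−(j+1)) z`. -/
theorem pullThrough_resum (E : Matrix (Orb Λ) (Orb Λ) ℂ) (hE : ∀ q k : Orb Λ, (ofLex q).2 ≠ (ofLex k).2 → E q k = 0)
    (σ : Fin 2) (w : ℕ → Λ → ℂ) (m : ℕ) (x : Λ) :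
    ∑ z : Λ, E (orb x σ) (orb z σ) * w m z -
        ∑ y : Λ, E (orb x σ) (orb y σ) *
          ∑ j ∈ Finset.range m, (-1) ^ j * ∑ z : Λ, (E ^ (j + 1)) (orb y σ) (orb z σ) * w (m - (j + 1)) z =
      ∑ j ∈ Finset.range (m + 1), (-1) ^ j * ∑ z : Λ, (E ^ (j + 1)) (orb x σ) (orb z σ) * w (m + 1 - (j + 1)) z := by
  -- `(E^{j+2})_{xσ,zσ} = Σ_y E_{xσ,yσ} (E^{j+1})_{yσ,zσ}`
  have hpow : ∀ (j : ℕ) (z : Λ), (E ^ (j + 1 + 1)) (orb x σ) (orb z σ) =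
      ∑ y : Λ, E (orb x σ) (orb y σ) * (E ^ (j + 1)) (orb y σ) (orb z σ) := by
    intro j z
    rw [pow_succ' E (j + 1), Matrix.mul_apply, sum_orb_eq_sum_sum]
    refine Finset.sum_congr rfl fun y _ => ?_
    rw [Finset.sum_eq_single σ]
    · intro τ _ hτ
      rw [hE (orb x σ) (orb y τ) (Ne.symm hτ), zero_mul]
    · intro hσ; exact absurd (Finset.mem_univ σ) hσ
  rw [Finset.sum_range_succ', zero_add, pow_one, pow_zero, one_mul, Nat.add_sub_cancel]
  have hswap : ∑ y : Λ, E (orb x σ) (orb y σ) *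
      ∑ j ∈ Finset.range m, (-1) ^ j * ∑ z : Λ, (E ^ (j + 1)) (orb y σ) (orb z σ) * w (m - (j + 1)) z =
      ∑ j ∈ Finset.range m, (-1) ^ j * ∑ z : Λ, (E ^ (j + 1 + 1)) (orb x σ) (orb z σ) * w (m - (j + 1)) z := by
    simp only [Finset.mul_sum, hpow, Finset.sum_mul]
    rw [Finset.sum_comm]
    refine Finset.sum_congr rfl fun j _ => ?_
    rw [Finset.sum_comm]
    refine Finset.sum_congr rfl fun z _ => Finset.sum_congr rfl fun y _ => ?_
    ring
  rw [hswap]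
  have hsign : ∀ j : ℕ, ((-1 : ℂ) ^ (j + 1)) = -((-1) ^ j) := fun j => by rw [pow_succ]; ring
  simp only [hsign, neg_mul, Finset.sum_neg_distrib, show ∀ j : ℕ, m + 1 - (j + 1 + 1) = m - (j + 1) from fun j => by omega]
  ring

/-- **The canonical pull-through expansion.** Let `E = e^{−βh}` be spin-block-diagonal and `(P_m)` a family with `P_m c_{xσ} = c_{xσ} P_{m+1}`
for all `m, x` and `c_{xσ} P_0 = 0`. Then for every operator `A`, orbital `p`, site `x` and every `m`,
`tr(P_m e^{−βdΓ(h)} A c†_p c_{xσ}) = Σ_{j<m} (−1)^j Σ_y (E^{j+1})_{xσ,yσ} ( [yσ = p] tr(P_{m−j−1} e^{−βdΓ(h)} A) + tr(P_{m−j−1} e^{−βdΓ(h)} [c_{yσ},A] c†_p) )`. -/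
theorem trace_P_mul_gibbsWeight_dGamma_mul_expansion (β : ℝ) (h : Matrix (Orb Λ) (Orb Λ) ℂ)
    (hE : ∀ q k : Orb Λ, (ofLex q).2 ≠ (ofLex k).2 → (exp (-((β : ℂ) • h))) q k = 0) (σ : Fin 2)
    (P : ℕ → Matrix (Finset (Orb Λ)) (Finset (Orb Λ)) ℂ)
    (hPc : ∀ (m : ℕ) (x : Λ), P m * annihilation (orb x σ) = annihilation (orb x σ) * P (m + 1))
    (hP0 : ∀ x : Λ, annihilation (orb x σ) * P 0 = 0)
    (A : Matrix (Finset (Orb Λ)) (Finset (Orb Λ)) ℂ) (p : Orb Λ) (m : ℕ) (x : Λ) :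
    (P m * gibbsWeight β (dGamma h) * (A * (creation p * annihilation (orb x σ)))).trace =
      ∑ j ∈ Finset.range m, (-1) ^ j * ∑ y : Λ, ((exp (-((β : ℂ) • h))) ^ (j + 1)) (orb x σ) (orb y σ) *
        ((if orb y σ = p then (P (m - (j + 1)) * gibbsWeight β (dGamma h) * A).trace else 0) +
          (P (m - (j + 1)) * gibbsWeight β (dGamma h) *
            ((annihilation (orb y σ) * A - A * annihilation (orb y σ)) * creation p)).trace) := by
  induction m generalizing x with
  | zero =>
    rw [Finset.range_zero, Finset.sum_empty]
    exact trace_P_zero_mul_gibbsWeight_mul_eq_zero β (dGamma h) (P 0) (hP0 x) A p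
  | succ m ih =>
    rw [trace_P_succ_mul_gibbsWeight_dGamma_mul β h hE σ (P m) (P (m + 1)) x (hPc m x) A p]
    simp only [ih, mul_sub, Finset.sum_sub_distrib]
    exact pullThrough_resum (exp (-((β : ℂ) • h))) hE σ
      (fun n z => (if orb z σ = p then (P n * gibbsWeight β (dGamma h) * A).trace else 0) +
        (P n * gibbsWeight β (dGamma h) * ((annihilation (orb z σ) * A - A * annihilation (orb z σ)) * creation p)).trace) m x

/-! ## §3 The bond current: cancellation of the `A`-terms -/

/-- **Current form of the expansion.** For the spin-`σ` bond current `j = −i c†_{aσ} c_{bσ} + i c†_{bσ} c_{aσ}` between two sites `a, b`,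
if the powers `E^{j+1}` are symmetric on the pair then the `tr(P e^{−βdΓ(h)} A)`-terms cancel and
`tr(P_m e^{−βdΓ(h)} A j) = i Σ_{j<m} (−1)^j Σ_y ( (E^{j+1})_{aσ,yσ} tr(P_{m−j−1} e^{−βdΓ(h)} [c_{yσ},A] c†_{bσ}) − (E^{j+1})_{bσ,yσ} tr(… [c_{yσ},A] c†_{aσ}) )`. -/
theorem trace_P_mul_gibbsWeight_dGamma_mul_current (β : ℝ) (h : Matrix (Orb Λ) (Orb Λ) ℂ)
    (hE : ∀ q k : Orb Λ, (ofLex q).2 ≠ (ofLex k).2 → (exp (-((β : ℂ) • h))) q k = 0) (σ : Fin 2)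
    (P : ℕ → Matrix (Finset (Orb Λ)) (Finset (Orb Λ)) ℂ)
    (hPc : ∀ (m : ℕ) (x : Λ), P m * annihilation (orb x σ) = annihilation (orb x σ) * P (m + 1))
    (hP0 : ∀ x : Λ, annihilation (orb x σ) * P 0 = 0)
    (A : Matrix (Finset (Orb Λ)) (Finset (Orb Λ)) ℂ) (a b : Λ)
    (hsymm : ∀ j : ℕ, ((exp (-((β : ℂ) • h))) ^ (j + 1)) (orb a σ) (orb b σ) = ((exp (-((β : ℂ) • h))) ^ (j + 1)) (orb b σ) (orb a σ))
    (m : ℕ) :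
    (P m * gibbsWeight β (dGamma h) *
        (A * ((-Complex.I) • (creation (orb a σ) * annihilation (orb b σ)) + Complex.I • (creation (orb b σ) * annihilation (orb a σ))))).trace =
      Complex.I * ∑ j ∈ Finset.range m, (-1) ^ j * ∑ y : Λ,
        (((exp (-((β : ℂ) • h))) ^ (j + 1)) (orb a σ) (orb y σ) *
            (P (m - (j + 1)) * gibbsWeight β (dGamma h) *
              ((annihilation (orb y σ) * A - A * annihilation (orb y σ)) * creation (orb b σ))).trace -
          ((exp (-((β : ℂ) • h))) ^ (j + 1)) (orb b σ) (orb y σ) *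
            (P (m - (j + 1)) * gibbsWeight β (dGamma h) *
              ((annihilation (orb y σ) * A - A * annihilation (orb y σ)) * creation (orb a σ))).trace) := by
  set W := gibbsWeight β (dGamma h) with hW
  set E := exp (-((β : ℂ) • h)) with hEdef
  have hlin : (P m * W * (A * ((-Complex.I) • (creation (orb a σ) * annihilation (orb b σ)) +
      Complex.I • (creation (orb b σ) * annihilation (orb a σ))))).trace =
      (-Complex.I) * (P m * W * (A * (creation (orb a σ) * annihilation (orb b σ)))).trace +
        Complex.I * (P m * W * (A * (creation (orb b σ) * annihilation (orb a σ)))).trace := by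
    rw [Matrix.mul_add, Matrix.mul_smul, Matrix.mul_smul, Matrix.mul_add, Matrix.mul_smul, Matrix.mul_smul, Matrix.trace_add,
      Matrix.trace_smul, Matrix.trace_smul, smul_eq_mul, smul_eq_mul]
  rw [hlin, hW, trace_P_mul_gibbsWeight_dGamma_mul_expansion β h hE σ P hPc hP0 A (orb a σ) m b,
    trace_P_mul_gibbsWeight_dGamma_mul_expansion β h hE σ P hPc hP0 A (orb b σ) m a, ← hW, ← hEdef]
  -- the `[y = a]` / `[y = b]` terms
  have hδ : ∀ (u v : Λ) (j : ℕ), ∑ y : Λ, (E ^ (j + 1)) (orb u σ) (orb y σ) *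
      ((if orb y σ = orb v σ then (P (m - (j + 1)) * W * A).trace else 0) +
        (P (m - (j + 1)) * W * ((annihilation (orb y σ) * A - A * annihilation (orb y σ)) * creation (orb v σ))).trace) =
      (E ^ (j + 1)) (orb u σ) (orb v σ) * (P (m - (j + 1)) * W * A).trace +
        ∑ y : Λ, (E ^ (j + 1)) (orb u σ) (orb y σ) *
          (P (m - (j + 1)) * W * ((annihilation (orb y σ) * A - A * annihilation (orb y σ)) * creation (orb v σ))).trace := by
    intro u v j
    rw [← Finset.sum_add_distrib.symm.trans (Finset.sum_congr rfl fun y _ => (mul_add _ _ _).symm)]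
    congr 1
    rw [Finset.sum_eq_single v]
    · rw [if_pos rfl]
    · intro y _ hy
      rw [if_neg (fun h' => hy (orb_inj.1 h').1), mul_zero]
    · intro hv; exact absurd (Finset.mem_univ v) hv
  simp only [hδ, hsymm]
  rw [Finset.mul_sum, Finset.mul_sum, Finset.mul_sum, ← Finset.sum_add_distrib]
  refine Finset.sum_congr rfl fun j _ => ?_
  rw [Finset.sum_sub_distrib]
  ring

end Summit.Ventures.CertifiedManyBodySolver.Theorems.TcThermcert1.FreeGasCurrentClustering

end
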